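import Summits.BirchSwinnertonDyer.BirchSwinnertonDyer.Theorems.PrintCFramBottomClassIndexLawFiveLeRegularLocusTowerDescent
import Summits.BirchSwinnertonDyer.BirchSwinnertonDyer.Theorems.PrintCFramBottomClassIndexLawFiveLeRegularLocusCharTrivial
import Summits.BirchSwinnertonDyer.BirchSwinnertonDyer.Theorems.PrintCFramBottomClassIndexLawFiveLeEisensteinRegularLocusBSDp
import Literature.NumberTheory.EllipticCurves.ArchimedeanKummerImageMaximal
import Literature.NumberTheory.EllipticCurves.ZpExtensionUnramifiedProofs
import HarnessLib

/-!
# Route `PrintCFram`, crux C2 `BottomClassIndexLawFiveLe` (stmt-BirchSwinnertonDyer-20372), line `eisenstein-resource-bdp-line`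
# (registry v5): the REGULAR LOCUS read with BOTTOM-LAYER regularity — the residual Selmer groups of the isogeny line
# over the Heegner field `K''` ITSELF, not over `K''_∞`

Cell `bsd-print-cfram`, width seat `bsd-line-cfram-p1-w2` (generation g4); helper `--supports stmt-BirchSwinnertonDyer-20372`;
companion of `…RegularLocusTowerDescent` (p631615). THEOREMS ONLY (0 definitions, 0 named facts, 0 instances, no `sorry`).
HONEST FRAMING: nothing about BSD is proved unconditionally; the crux (all `W`, all frames) is NOT closed; no stub of the
line is closed. BSD is not proved by any of this; no summit statement is proved by this seat.

## What is proved

* §1 `residualSelmer_eq_bot_iff_layer_holds` — the tower descent of `…RegularLocusTowerDescent.residualSelmer_eq_bot_iff_layer`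
  with its unramifiedness hypothesis DISCHARGED: every `ℤ_p`-extension of a number field is unramified outside `p`
  (Washington Prop. 13.2, PROVED in the tree without class field theory as `ZpExtension.inertia_le_kerSubgroup_holds`). So for
  any `κ`, any discrete `p`-primary `M` with continuous orbit maps and no non-zero `ker κ ⊓ D_𝔭`-fixed vector, any `S₀`, `n`:
  `R_𝔭^{S₀}(K_∞, M) = 0 ↔ R_𝔭^{S₀}(K_n, M) = 0` — no displayed hypothesis left besides the non-anomalous clause.
* §2 (the CM-ramified class) `natCard_residualSelmer_eq_one_of_bottom` (any elliptic curve over a number field, any `κ`, any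
  stable `Φ ≤ E[p]` with both non-anomalous clauses: bottom-layer vanishing ⟹ `#R(K_∞, Φ) = #R(K_∞, E[p]/Φ) = 1`);
  **`hasCharValuationAt_zero_cmRamified_of_regular_bottom`** — LEAD g5's `RegularLocus.hasCharValuationAt_zero_cmRamified_of_regular`
  with the regularity hypothesis moved from `K''_∞` to `K''`: IF some stable line `Φ ≤ W_{K''}[p]` with no non-zero
  `ker κ ⊓ D_𝔭`-fixed vector in `Φ` nor in `W_{K''}[p]/Φ` (on the class: the kernel of the certified rational `p`-isogeny,
  LEAD g4 `IsogenyLineData.exists_line_noFixed_of_isogeny`, which supplies BOTH clauses) has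
  `R_𝔭^S(K'', Φ) = R_𝔭^S(K'', W[p]/Φ) = 0` at the bad set `S`, THEN the frame is regular (`XAc.HasCharValuationAt … 0`);
  **`bsdp_cmRamified_of_regular_bottom_of_padicLogOrd`** and **`ramifiedCMBottomClassIndexLawAtZp_of_regular_bottom_of_padicLogOrd`**
  — w4's regular-frame `BSD_p(W)` / crux-conclusion theorems fed with it: for `W` CM, `p ≥ 5` CM-ramified, `r_an = 1`, ONE
  Heegner datum and ONE frame, BOTTOM-LAYER regularity + the one number `ord_p log_{ω_W}(P) = v_p(c)` ⟹ `BSDp W p` and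
  `X12.O11.RamifiedCMBottomClassIndexLawAtZp W p`, modulo `ToricPublishedInputs`, Poitou–Tate for Ш, Burungale–Flach, modularity
  (+ Cassels, GZK for the crux's conclusion). NO main conjecture, NO `p`-adic `L`-function, NO CGLS Prop. 14, NO class field theory.

READING. The two residual Selmer groups over `K''` are subgroups of the finite groups `H¹(K''_Σ/K'', 𝔽_p(θ))`,
`H¹(K''_Σ/K'', 𝔽_p(θω^{-1}…))` cut out by «unramified off `Σ`, split at `𝔭`, free at `𝔭̄` and at the bad primes» — by class
field theory over `K''(θ)` a `θ`-piece of a ray class group: Kriz–Li's «relative `p`-class numbers … trivial» (FMS 2019 p. 3)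
AT THE BOTTOM LAYER, certifiable per datum by a finite computation, and class-wide one Gras-type theorem away from the two
Bernoulli numbers of Kriz–Li Thm. 1.20 (4). Nothing of that dictionary is asserted here.

References: Greenberg, LNM 1716 (1999) §3 Lemmas 3.1–3.2; Washington Prop. 13.2; Lang, *Cyclotomic Fields I–II* Ch. 5 §1;
Castella–Grossi–Lee–Skinner 2022 §1.2, §3 (arXiv:2008.02571); Kriz–Li 2019 p. 3, Thm. 1.20, Rmk. 1.21; Jetchev–Skinner–Wan 2017 §7.4.1.
-/

set_option autoImplicit false
-- the summit namespace `Summit.BirchSwinnertonDyer.BirchSwinnertonDyer` repeats the problem name by design (D-0017)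
set_option linter.dupNamespace false

noncomputable section

open scoped Classical

namespace Summit.BirchSwinnertonDyer.BirchSwinnertonDyer.Theorems.PrintCFram.RegularLocusBottomLayer

open WeierstrassCurve NumberField IsDedekindDomain Field
  Literature.NumberTheory.EllipticCurves Literature.NumberTheory.EllipticCurves.GreenbergSelmer
  Literature.NumberTheory.EllipticCurves.GreenbergVatsal2000
  Literature.NumberTheory.EllipticCurves.ModularForms Literature.NumberTheory.EllipticCurves.Rank1Residual
  Literature.NumberTheory.EllipticCurves.Rank1Residual.Typed
  Literature.NumberTheory.GaloisRepresentations Literature.NumberTheory.GaloisCohomology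
  Summit.BirchSwinnertonDyer.BirchSwinnertonDyer.Theses.UniversalToricDescent
  Summit.BirchSwinnertonDyer.Rank1Residual Summit.BirchSwinnertonDyer.Rank1Residual.Additive
  Summit.BirchSwinnertonDyer.Rank1Residual.X11b Summit.BirchSwinnertonDyer.Rank1Residual.X11b.AcSelmer
  Summit.BirchSwinnertonDyer.Rank1Residual.X12
  Summit.BirchSwinnertonDyer.Rank1Residual.X2.ResidualDevissageModules
  Summit.BirchSwinnertonDyer.BirchSwinnertonDyer.Theorems
  Summit.BirchSwinnertonDyer.BirchSwinnertonDyer.Theorems.SchneiderFree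
  Summit.BirchSwinnertonDyer.BirchSwinnertonDyer.Theorems.RamifiedSevenEllipticUnits
  Summit.BirchSwinnertonDyer.BirchSwinnertonDyer.Theorems.PrintCFram
  Summit.BirchSwinnertonDyer.BirchSwinnertonDyer.Theorems.PrintCFram.RegularLocusTowerDescent
  Summit.BirchSwinnertonDyer.BirchSwinnertonDyer.Theorems.CumulativeHeegnerInclusionAtThreeResidualDevissage

/-! ## §1 Generic complement: the descent from the printed input (Washington Prop. 13.2) -/

section Generic

variable {K : Type} [Field K] [NumberField K] {p : ℕ} [Fact p.Prime] (κ : ZpExtension K p)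
  {M : Type} [AddCommGroup M] [DistribMulAction (absoluteGaloisGroup K) M] [TopologicalSpace M]
  [DiscreteTopology M]

/-- **Tower descent, unconditionally in the unramifiedness**: `K_∞/K` IS unramified outside `p` for every
`ℤ_p`-extension of a number field (Washington Prop. 13.2 — PROVED in the tree without class field theory,
`ZpExtension.inertia_le_kerSubgroup_holds`, Lang's local argument), so the residual Selmer group `R_𝔭^{S₀}(·, M)` of a
discrete `p`-primary `M` with no non-zero `ker κ ⊓ D_𝔭`-fixed vector vanishes over `K_∞` iff it vanishes over `K_n`, for
every `S₀` and every `n`. [cite: Washington1997, Prop. 13.2] [cite: GreenbergLNM1716, §3 Lemmas 3.1–3.2 (PDF p. 86)] -/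
theorem residualSelmer_eq_bot_iff_layer_holds {γ : absoluteGaloisGroup K} (hγ : κ.IsTopGenerator γ)
    (hcont : ∀ m : M, Continuous fun g : absoluteGaloisGroup K ↦ g • m)
    (htor : ∀ m : M, ∃ k : ℕ, p ^ k • m = 0) (𝔭 : HeightOneSpectrum (𝓞 K))
    (S₀ : Set (HeightOneSpectrum (𝓞 K))) (n : ℕ)
    (hM𝔭 : ∀ m : M, (∀ g ∈ κ.kerSubgroup ⊓ decomp 𝔭, g • m = m) → m = 0) :
    datumStrictSelmer κ.kerSubgroup M p (AcSelmer.bdpData M p 𝔭) S₀ = ⊥ ↔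
      datumStrictSelmer (κ.layerSubgroup n) M p (AcSelmer.bdpData M p 𝔭) S₀ = ⊥ :=
  residualSelmer_eq_bot_iff_layer κ hγ hcont htor 𝔭 S₀ n
    (fun v _ hpv ↦ by
      have e : inertia v = (adicCompletionPrime K v).inertia (absoluteGaloisGroup K) :=
        (inertia_adicCompletionPrime_eq_map_absInertia K v).symm
      rw [e]
      exact ZpExtension.inertia_le_kerSubgroup_holds K p κ hpv (adicCompletionPrime_mem_primesAbove K v))
    hM𝔭

end Generic

/-! ## §2 The CM-ramified class: regularity AT THE BOTTOM LAYER suffices -/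

section Class

variable {p : ℕ} [Fact p.Prime]

/-- **Bottom-layer regularity of a line ⟹ top-of-tower regularity** (the hypothesis `hreg` of LEAD g5's
`RegularLocus.hasCharValuationAt_zero_cmRamified_of_regular` and of w4's `htriv`), for an elliptic curve `E` over a
number field `K`, any `ℤ_p`-extension `κ` with a topological generator, a prime `𝔭 ∋ p`, and a `Γ_K`-stable `Φ ≤ E[p]`
with no non-zero `ker κ ⊓ D_𝔭`-fixed vector in `Φ` NOR in `E[p]/Φ`: if both residual Selmer groups `R_𝔭^S(K, Φ)`, `R_𝔭^S(K, E[p]/Φ)` over `K` ITSELF (layer `0`) vanish, then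
`#R_𝔭^S(K_∞, Φ) = #R_𝔭^S(K_∞, E[p]/Φ) = 1`. [cite: GreenbergLNM1716, §3 Lemmas 3.1–3.2 (PDF p. 86)]
[cite: CastellaGrossiLeeSkinner2022, §1.2 Def. 10, Prop. 14 (arXiv:2008.02571)] -/
theorem natCard_residualSelmer_eq_one_of_bottom {K : Type} [Field K] [NumberField K]
    (E : WeierstrassCurve K) (κ : ZpExtension K p) {γ : absoluteGaloisGroup K} (hγ : κ.IsTopGenerator γ)
    (𝔭 : HeightOneSpectrum (𝓞 K)) (S : Set (HeightOneSpectrum (𝓞 K)))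
    (Φ : X2.ResidualDevissageModules.StableSubgroup (absoluteGaloisGroup K) (E.geomTorsion (p : ℤ)))
    (hfixS : ∀ x : Φ.Sub, (∀ σ ∈ κ.kerSubgroup ⊓ decomp 𝔭, σ • x = x) → x = 0)
    (hfixQ : ∀ y : Φ.Quot, (∀ σ ∈ κ.kerSubgroup ⊓ decomp 𝔭, σ • y = y) → y = 0)
    (hS0 : datumStrictSelmer (κ.layerSubgroup 0) Φ.Sub p (AcSelmer.bdpData Φ.Sub p 𝔭) S = ⊥)
    (hQ0 : datumStrictSelmer (κ.layerSubgroup 0) Φ.Quot p (AcSelmer.bdpData Φ.Quot p 𝔭) S = ⊥) :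
    Nat.card (datumStrictSelmer κ.kerSubgroup Φ.Sub p (AcSelmer.bdpData Φ.Sub p 𝔭) S) = 1 ∧
      Nat.card (datumStrictSelmer κ.kerSubgroup Φ.Quot p (AcSelmer.bdpData Φ.Quot p 𝔭) S) = 1 := by
  have hM : ∀ m : E.geomTorsion (p : ℤ), Continuous fun g : absoluteGaloisGroup K ↦ g • m :=
    continuous_smul_geomTorsion E (p : ℤ)
  have htorE : ∀ m : E.geomTorsion (p : ℤ), p • m = 0 := fun m ↦ by
    have h := E.natAbs_nsmul_geomTorsion m
    rwa [Int.natAbs_natCast] at h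
  have htorS : ∀ x : Φ.Sub, ∃ k : ℕ, p ^ k • x = 0 := fun x ↦ ⟨1, by
    rw [pow_one]
    exact Φ.incl_injective (by rw [map_nsmul, htorE, map_zero])⟩
  have htorQ : ∀ y : Φ.Quot, ∃ k : ℕ, p ^ k • y = 0 := fun y ↦ ⟨1, by
    rw [pow_one]; exact Φ.nsmul_quot_eq_zero htorE y⟩
  have hS := (residualSelmer_eq_bot_iff_layer_holds κ hγ (Φ.continuous_smul_sub hM) htorS 𝔭 S 0 hfixS).mpr hS0
  have hQ := (residualSelmer_eq_bot_iff_layer_holds κ hγ (Φ.continuous_smul_quot hM) htorQ 𝔭 S 0 hfixQ).mpr hQ0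
  constructor
  · rw [hS]; exact AddSubgroup.card_bot
  · rw [hQ]; exact AddSubgroup.card_bot

/-- **REGULAR FRAME FROM THE BOTTOM LAYER, on the CM-ramified class.** For `W/ℚ` globally minimal with CM, `p ≥ 5`
CM-ramified, a Heegner field `K''` of `N_W`, a `ℤ_p`-extension `κ` of `K''` with topological generator `γ`, and a prime
`𝔭 ∋ p`: IF some `Γ_{K''}`-stable
line `Φ ≤ W_{K''}[p]` with no non-zero `ker κ ⊓ D_𝔭`-fixed vector in `Φ` nor in `W_{K''}[p]/Φ` (on the class: the kernel
of the certified rational `p`-isogeny, `IsogenyLineData.exists_line_noFixed_of_isogeny`) has TRIVIAL residual Selmer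
groups OVER `K''` — `R_𝔭^S(K'', Φ) = R_𝔭^S(K'', W[p]/Φ) = 0` at the bad set `S` — THEN the frame `(κ, γ, 𝔭)` is regular:
`XAc.HasCharValuationAt (W.baseChange K'') p κ 𝔭 ∅ γ 0`. (LEAD g5's `hasCharValuationAt_zero_cmRamified_of_regular`
after the tower descent.) [cite: GreenbergLNM1716, §3 Lemmas 3.1–3.2 (PDF p. 86)]
[cite: CastellaGrossiLeeSkinner2022, §3 Thm. 3.2.1 and Props. 14, 17, 18 (arXiv:2008.02571)] [cite: KrizLi2019, p. 3 and Thm. 1.20] -/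
theorem hasCharValuationAt_zero_cmRamified_of_regular_bottom
    (W : WeierstrassCurve ℚ) [W.IsElliptic] [W.IsGloballyMinimal] (hCM : W.HasCM) (hram : CMRamified W p) (h5 : 5 ≤ p)
    {N : ℕ} [NeZero N] {K : Type} [Field K] [NumberField K]
    (hN : W.conductorNorm ℤ = N) (hK : IsImaginaryQuadratic K) (hHN : SatisfiesHeegnerHypothesis N K)
    (κ : ZpExtension K p) (γ : Field.absoluteGaloisGroup K) [hγ : Fact (κ.IsTopGenerator γ)]
    (𝔭 : HeightOneSpectrum (𝓞 K)) (h𝔭 : ((p : ℕ) : 𝓞 K) ∈ 𝔭.asIdeal)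
    (hreg0 : ∃ Φ : X2.ResidualDevissageModules.StableSubgroup (absoluteGaloisGroup K) ((W.baseChange K).geomTorsion (p : ℤ)),
      (∀ x : Φ.Sub, (∀ σ ∈ κ.kerSubgroup ⊓ decomp 𝔭, σ • x = x) → x = 0) ∧
      (∀ y : Φ.Quot, (∀ σ ∈ κ.kerSubgroup ⊓ decomp 𝔭, σ • y = y) → y = 0) ∧
      datumStrictSelmer (κ.layerSubgroup 0) Φ.Sub p (AcSelmer.bdpData Φ.Sub p 𝔭)
          {v : HeightOneSpectrum (𝓞 K) | ¬ (W.baseChange K).HasGoodReductionAt v ∧ ((p : ℕ) : 𝓞 K) ∉ v.asIdeal} = ⊥ ∧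
      datumStrictSelmer (κ.layerSubgroup 0) Φ.Quot p (AcSelmer.bdpData Φ.Quot p 𝔭)
          {v : HeightOneSpectrum (𝓞 K) | ¬ (W.baseChange K).HasGoodReductionAt v ∧ ((p : ℕ) : 𝓞 K) ∉ v.asIdeal} = ⊥) :
    XAc.HasCharValuationAt (W.baseChange K) p κ 𝔭 ∅ γ 0 := by
  haveI hEK : (W.baseChange K).IsElliptic := inferInstanceAs (W.map (algebraMap ℚ K)).IsElliptic
  obtain ⟨Φ, hfixS, hfixQ, hS0, hQ0⟩ := hreg0
  obtain ⟨h1, h2⟩ := natCard_residualSelmer_eq_one_of_bottom (W.baseChange K) κ hγ.out 𝔭 _ Φ hfixS hfixQ hS0 hQ0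
  exact RegularLocus.hasCharValuationAt_zero_cmRamified_of_regular W hCM hram h5 hN hK hHN κ γ 𝔭 h𝔭
    ⟨Φ, fun y hy ↦ hfixQ y fun σ hσ ↦ hy ⟨σ, hσ⟩, h1, h2⟩

/-- **`BSD_p(W)` from BOTTOM-LAYER regularity and ONE number** (w4's `bsdp_cmRamified_of_regularFrame_of_padicLogOrd` fed with
the regular frame above): for `W` CM, `p ≥ 5` CM-ramified, `r_an = 1`, ONE Heegner datum `(K'', P)` (`d_{K''}` odd `< −4`,
`L(W^{(d)},1) ≠ 0`), ONE anticyclotomic frame `(κ, γ, 𝔭 ∋ p)` of `K''` at which some stable line with both non-anomalous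
clauses has trivial residual Selmer groups OVER `K''` ITSELF, and `ord_p log_{ω_W}(P) = v_p(c)` (two displayed inequalities;
`≤` is the shape of Kriz–Li Thm. 1.20): `BSDp W p`, modulo `ToricPublishedInputs`, Poitou–Tate for Ш, Burungale–Flach,
modularity. NO main conjecture, NO `p`-adic `L`-function, NO CGLS Prop. 14, NO class field theory. CONDITIONAL; BSD is not
proved by any of this. [cite: KrizLi2019, Thm. 1.20, Rmk. 1.21 and p. 3 (doi:10.1017/fms.2019.9)]
[cite: GreenbergLNM1716, §3 Lemmas 3.1–3.2 (PDF p. 86)] [cite: JetchevSkinnerWan2017, §7.4.1 and Thm. 3.3.1 (arXiv:1512.06894)] -/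
theorem bsdp_cmRamified_of_regular_bottom_of_padicLogOrd (hF : ToricPublishedInputs)
    (hPT2 : ∀ (K : Type) [Field K] [NumberField K], poitouTate_sha_tateDual K)
    (hBF : bsdTriple_of_hasCM_of_L_one_ne_zero) (hmod : hasEntireLFunction_rat)
    (W : WeierstrassCurve ℚ) [W.IsElliptic] [W.IsGloballyMinimal] (hCM : W.HasCM) (hram : CMRamified W p) (h5 : 5 ≤ p)
    (hr : W.analyticRank = 1) (N : ℕ) [NeZero N] (K : Type) [Field K] [NumberField K]
    (Dt : ModularParametrizationData W N) (H : HeegnerDatum N (NumberField.discr K)) (ι : K →+* ℂ)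
    (P : (W.baseChange K).toAffine.Point) (hN : W.conductorNorm ℤ = N) (hK : IsImaginaryQuadratic K)
    (hodd : Odd (NumberField.discr K)) (hd4 : NumberField.discr K < -4) (hHH : SatisfiesHeegnerHypothesis N K)
    (hLd : (W.quadraticTwist (NumberField.discr K : ℚ)).entireLFunction 1 ≠ 0)
    (hP : WeierstrassCurve.Affine.Point.map ι.toRatAlgHom P = heegnerPointComplex Dt H)
    (κ : ZpExtension K p) (hκ : κ.IsAnticyclotomic) (γ : absoluteGaloisGroup K) [Fact (κ.IsTopGenerator γ)]
    (𝔭 : HeightOneSpectrum (𝓞 K)) (h𝔭 : ((p : ℕ) : 𝓞 K) ∈ 𝔭.asIdeal) (he : 𝔭.asIdeal.ramificationIdx (𝓞 ℚ) = 1)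
    (hf : 𝔭.asIdeal.inertiaDeg (𝓞 ℚ) = 1)
    (hreg0 : ∃ Φ : X2.ResidualDevissageModules.StableSubgroup (absoluteGaloisGroup K) ((W.baseChange K).geomTorsion (p : ℤ)),
      (∀ x : Φ.Sub, (∀ σ ∈ κ.kerSubgroup ⊓ decomp 𝔭, σ • x = x) → x = 0) ∧
      (∀ y : Φ.Quot, (∀ σ ∈ κ.kerSubgroup ⊓ decomp 𝔭, σ • y = y) → y = 0) ∧
      datumStrictSelmer (κ.layerSubgroup 0) Φ.Sub p (AcSelmer.bdpData Φ.Sub p 𝔭)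
          {v : HeightOneSpectrum (𝓞 K) | ¬ (W.baseChange K).HasGoodReductionAt v ∧ ((p : ℕ) : 𝓞 K) ∉ v.asIdeal} = ⊥ ∧
      datumStrictSelmer (κ.layerSubgroup 0) Φ.Quot p (AcSelmer.bdpData Φ.Quot p 𝔭)
          {v : HeightOneSpectrum (𝓞 K) | ¬ (W.baseChange K).HasGoodReductionAt v ∧ ((p : ℕ) : 𝓞 K) ∉ v.asIdeal} = ⊥)
    (hlogle : X11b.padicLogOrd W p (embAt K p 𝔭 h𝔭 he hf) P ≤ (padicValNat p Dt.c.natAbs : ℤ))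
    (hlogge : (padicValNat p Dt.c.natAbs : ℤ) ≤ X11b.padicLogOrd W p (embAt K p 𝔭 h𝔭 he hf) P) :
    BSDp W p :=
  EisensteinRegularLocus.bsdp_cmRamified_of_regularFrame_of_padicLogOrd hF hPT2 hBF hmod W hCM hram h5 hr N K Dt H ι P hN
    hK hodd hd4 hHH hLd hP κ hκ γ 𝔭 h𝔭 he hf
    (hasCharValuationAt_zero_cmRamified_of_regular_bottom W hCM hram h5 hN hK hHH κ γ 𝔭 h𝔭 hreg0) hlogle hlogge

/-- **The crux's CONCLUSION for `W` from BOTTOM-LAYER regularity and ONE number.** For `W` CM, `p ≥ 5` CM-ramified,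
`r_an = 1`, ONE Heegner datum `(K'', P)` (`d_{K''}` odd `< −4`, `L(W^{(d)},1) ≠ 0`), ONE anticyclotomic frame `(κ, γ, 𝔭 ∋ p)`
of `K''` at which some stable line with both non-anomalous clauses has trivial residual Selmer groups OVER `K''` ITSELF, and `ord_p log_{ω_W}(P) = v_p(c)`:
`X12.O11.RamifiedCMBottomClassIndexLawAtZp W p` — w4's `ramifiedCMBottomClassIndexLawAtZp_of_regularFrame_of_padicLogOrd` fed
with the regular frame above. Modulo `ToricPublishedInputs`, Poitou–Tate for Ш, Burungale–Flach, modularity, Cassels, GZK;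
NO main conjecture, NO `p`-adic `L`-function, NO CGLS Prop. 14. CONDITIONAL; the crux (all `W`, all frames) is NOT closed;
BSD is not proved by any of this. [cite: KrizLi2019, Thm. 1.20, Rmk. 1.21 and p. 3 (doi:10.1017/fms.2019.9)]
[cite: GreenbergLNM1716, §3 Lemmas 3.1–3.2 (PDF p. 86)] [cite: Miller2011LMS, Def. 1.1 (arXiv:1010.2431 p. 3)] -/
theorem ramifiedCMBottomClassIndexLawAtZp_of_regular_bottom_of_padicLogOrd (hF : ToricPublishedInputs)
    (hPT2 : ∀ (K : Type) [Field K] [NumberField K], poitouTate_sha_tateDual K)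
    (hBF : bsdTriple_of_hasCM_of_L_one_ne_zero) (hmod : hasEntireLFunction_rat) (hCassels : bsdRHS_eq_of_isIsogenous)
    (hGZK : rank_eq_analyticRank_of_analyticRank_le_one)
    (W : WeierstrassCurve ℚ) [W.IsElliptic] [W.IsGloballyMinimal] (hCM : W.HasCM) (hram : CMRamified W p) (h5 : 5 ≤ p)
    (hr : W.analyticRank = 1) (N : ℕ) [NeZero N] (K : Type) [Field K] [NumberField K]
    (Dt : ModularParametrizationData W N) (H : HeegnerDatum N (NumberField.discr K)) (ι : K →+* ℂ)
    (P : (W.baseChange K).toAffine.Point) (hN : W.conductorNorm ℤ = N) (hK : IsImaginaryQuadratic K)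
    (hodd : Odd (NumberField.discr K)) (hd4 : NumberField.discr K < -4) (hHH : SatisfiesHeegnerHypothesis N K)
    (hLd : (W.quadraticTwist (NumberField.discr K : ℚ)).entireLFunction 1 ≠ 0)
    (hP : WeierstrassCurve.Affine.Point.map ι.toRatAlgHom P = heegnerPointComplex Dt H)
    (κ : ZpExtension K p) (hκ : κ.IsAnticyclotomic) (γ : absoluteGaloisGroup K) [Fact (κ.IsTopGenerator γ)]
    (𝔭 : HeightOneSpectrum (𝓞 K)) (h𝔭 : ((p : ℕ) : 𝓞 K) ∈ 𝔭.asIdeal) (he : 𝔭.asIdeal.ramificationIdx (𝓞 ℚ) = 1)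
    (hf : 𝔭.asIdeal.inertiaDeg (𝓞 ℚ) = 1)
    (hreg0 : ∃ Φ : X2.ResidualDevissageModules.StableSubgroup (absoluteGaloisGroup K) ((W.baseChange K).geomTorsion (p : ℤ)),
      (∀ x : Φ.Sub, (∀ σ ∈ κ.kerSubgroup ⊓ decomp 𝔭, σ • x = x) → x = 0) ∧
      (∀ y : Φ.Quot, (∀ σ ∈ κ.kerSubgroup ⊓ decomp 𝔭, σ • y = y) → y = 0) ∧
      datumStrictSelmer (κ.layerSubgroup 0) Φ.Sub p (AcSelmer.bdpData Φ.Sub p 𝔭)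
          {v : HeightOneSpectrum (𝓞 K) | ¬ (W.baseChange K).HasGoodReductionAt v ∧ ((p : ℕ) : 𝓞 K) ∉ v.asIdeal} = ⊥ ∧
      datumStrictSelmer (κ.layerSubgroup 0) Φ.Quot p (AcSelmer.bdpData Φ.Quot p 𝔭)
          {v : HeightOneSpectrum (𝓞 K) | ¬ (W.baseChange K).HasGoodReductionAt v ∧ ((p : ℕ) : 𝓞 K) ∉ v.asIdeal} = ⊥)
    (hlogle : X11b.padicLogOrd W p (embAt K p 𝔭 h𝔭 he hf) P ≤ (padicValNat p Dt.c.natAbs : ℤ))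
    (hlogge : (padicValNat p Dt.c.natAbs : ℤ) ≤ X11b.padicLogOrd W p (embAt K p 𝔭 h𝔭 he hf) P) :
    X12.O11.RamifiedCMBottomClassIndexLawAtZp W p :=
  EisensteinRegularLocus.ramifiedCMBottomClassIndexLawAtZp_of_regularFrame_of_padicLogOrd hF hPT2 hBF hmod hCassels hGZK W
    hCM hram h5 hr N K Dt H ι P hN hK hodd hd4 hHH hLd hP κ hκ γ 𝔭 h𝔭 he hf
    (hasCharValuationAt_zero_cmRamified_of_regular_bottom W hCM hram h5 hN hK hHH κ γ 𝔭 h𝔭 hreg0) hlogle hlogge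

end Class

end Summit.BirchSwinnertonDyer.BirchSwinnertonDyer.Theorems.PrintCFram.RegularLocusBottomLayer

end
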